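import Summits.Ventures.LatticeQCDFlow.Scoring.U1TorusCharacterFormula
import HarnessLib

/-!
# Two distinct plaquettes of the 2-d `U(1)` torus: `⟨cos θ_p cos θ_q⟩ = Σ_k I_{|k|}^{V−2}(I_k')² / Σ_k I_{|k|}^V` exactly

HONEST FRAMING: exact (Metropolis-corrected) sampling algorithms for lattice gauge theory;
figures of merit are autocorrelation/cost numbers at stated couplings and volumes; no
continuum-physics claim.

Venture `LatticeQCDFlow` (cell pub-lqcd), sub-topic `Scoring`; FANOUT row 5 (`s0-sun-a`), GEN-13.
NEW WORK of the cell (placement rule).  `Scoring/U1TorusCharacterFormula.lean` (GEN-7) computes the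
plaquette `⟨cos θ_p⟩_{L₁×L₂,β} = Σ_k I_{|k|}^{V−1} I_k' / Σ_k I_{|k|}^V` (`I_k' = (I_{|k−1|}+I_{|k+1|})/2`) of the
2-d `U(1)` torus in the cell's coordinates (`u1WilsonExpect`: the S0-B target law `exp(β Σ_p cos θ_p) dθ`
on `(0,2π]^{links}`); GEN-12 typed the SU(2) 'error-bar oracle' and carried 'the U(1) analogue of the
variance oracle for the S0-B keys (needs a two-plaquette probe)' as NOT TYPED.  This file supplies it:

* §1 **probe characters with integer multiplicities** `s : ι → ℤ` on a closed connected complex: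
  `∫ e^{i Σ_p s_p θ_p} W = (2π)^{n+1} Σ_{k∈ℤ} ∏_p I_{|k − s_p|}(β_p)` (`setIntegral_cexp_mult_mul_weight`; the
  admissible dual assignments are `m = k − s`) and `∫ cos(Σ_p s_p θ_p) W =
  (2π)^{n+1} Σ_k (∏_p I_{|k−s_p|}(β_p) + ∏_p I_{|k+s_p|}(β_p))/2` (`setIntegral_cos_mult_mul_weight`) —
  generalising GEN-7's one-plaquette probe `s·𝟙_{p₀}` and GEN-8's region probe `s·𝟙_A`;
* §2 **two distinct plaquettes** `p ≠ q` (probes `𝟙_p ± 𝟙_q`):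
  `∫ cos θ_p cos θ_q W = (2π)^{n+1} Σ_k (∏_{r≠p,q} I_{|k|}(β_r)) I_k'(β_p) I_k'(β_q)`, hence
  **`u1WilsonExpect_cos_mul_cos`** and, at uniform coupling with `V = #ι`,
  `⟨cos θ_p cos θ_q⟩ = Σ_k I_{|k|}^{V−2} (I_k')² / Σ_k I_{|k|}^V` — THE SAME FOR EVERY PAIR, adjacent or not;
* §3 the `L₁ × L₂` torus (`torusInc`): **`torus_u1WilsonExpect_cos_mul_cos`**.

(On the torus the `V` plaquette angles are i.i.d. with density `∝ e^{β cos θ}` conditioned on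
`Σ_p θ_p ∈ 2πℤ`; `I_k'(β)` is the `k`-th Fourier coefficient of `cos θ · e^{β cos θ}`.)  The companion
`Scoring/U1TorusPlaquetteAverageVariance.lean` adds `⟨cos² θ_p⟩` and the variance of the volume-averaged
plaquette.  Elementary; nothing is cited (classical 2-d character expansion, Migdal 1975); no `def`.
-/

noncomputable section

open scoped Nat
open Real MeasureTheory Set Finset Literature.Analysis.FunctionSpaces

namespace Summit.Ventures.LatticeQCDFlow.Scoring

/-! ### 1. Probe characters with integer multiplicities -/

section Closed

variable {n : ℕ} {ι : Type*} [Fintype ι] [DecidableEq ι] (inc : ι → Fin (n + 1) → ℤ) (βp : ι → ℝ)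

omit [DecidableEq ι] in
/-- `Σ_p s_p θ_p = Σ_l (Σ_p s_p inc p l) θ_l` (lattice Stokes with multiplicities). -/
theorem sum_mul_u1PlaqAngle (s : ι → ℤ) (θ : Fin (n + 1) → ℝ) :
    ∑ p, (s p : ℝ) * u1PlaqAngle inc p θ = ∑ l, ((∑ p, s p * inc p l : ℤ) : ℝ) * θ l := by
  simp only [u1PlaqAngle, Finset.mul_sum, Int.cast_sum, Int.cast_mul, Finset.sum_mul, mul_assoc]
  exact Finset.sum_comm

omit [DecidableEq ι] in
/-- On a closed connected complex, the dual assignments compatible with the probe of multiplicity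
`s` are exactly `m = k − s`, `k ∈ ℤ`. -/
theorem linkConstraint_mult_iff_mem_range [Nonempty ι] (hclosed : ∀ l, ∑ p, inc p l = 0)
    (hconn : ∀ m : ι → ℤ, (∀ l, ∑ p, m p * inc p l = 0) → ∀ p q, m p = m q)
    (s : ι → ℤ) (m : ι → ℤ) :
    (∀ l, (∑ p, s p * inc p l) + ∑ p, m p * inc p l = 0) ↔
      m ∈ Set.range fun k : ℤ => fun p => k - s p := by
  obtain ⟨p₀⟩ := ‹Nonempty ι›
  constructor
  · intro h
    have h' : ∀ l, ∑ p, (m p + s p) * inc p l = 0 := by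
      intro l
      have := h l
      simp only [add_mul, Finset.sum_add_distrib]
      linarith
    refine ⟨m p₀ + s p₀, funext fun p => ?_⟩
    have hc := hconn _ h' p p₀
    simp only at hc ⊢
    linarith
  · rintro ⟨k, rfl⟩ l
    simp only [sub_mul, Finset.sum_sub_distrib, ← Finset.mul_sum, hclosed, mul_zero, zero_sub,
      add_neg_cancel]

omit [Fintype ι] [DecidableEq ι] in
/-- The parametrisation `k ↦ k − s` is injective (`ι` non-empty). -/
theorem injective_const_sub_mult [Nonempty ι] (s : ι → ℤ) :
    Function.Injective fun k : ℤ => fun p : ι => k - s p := by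
  obtain ⟨p₀⟩ := ‹Nonempty ι›
  intro k k' h
  have := congr_fun h p₀
  simpa using this

/-- **Probe character with multiplicities**:
`∫ e^{i Σ_p s_p θ_p} W dθ = (2π)^{n+1} Σ_{k ∈ ℤ} ∏_p I_{|k − s_p|}(β_p)`. -/
theorem setIntegral_cexp_mult_mul_weight [Nonempty ι] (hclosed : ∀ l, ∑ p, inc p l = 0)
    (hconn : ∀ m : ι → ℤ, (∀ l, ∑ p, m p * inc p l = 0) → ∀ p q, m p = m q) (s : ι → ℤ) :
    ∫ θ in u1TorusBox (n + 1),
        Complex.exp ((∑ p, (s p : ℂ) * (u1PlaqAngle inc p θ : ℂ)) * Complex.I) *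
          ((u1WilsonWeight univ inc βp θ : ℝ) : ℂ) =
      (2 * π : ℂ) ^ (n + 1) * ∑' k : ℤ, ∏ p, (besselI (k - s p).natAbs (βp p) : ℂ) := by
  have hphase : ∀ θ : Fin (n + 1) → ℝ, (∑ p, (s p : ℂ) * (u1PlaqAngle inc p θ : ℂ)) * Complex.I =
      (∑ l, (((∑ p, s p * inc p l : ℤ)) : ℂ) * θ l) * Complex.I := fun θ => by
    have h := congrArg (fun x : ℝ => (x : ℂ)) (sum_mul_u1PlaqAngle inc s θ)
    push_cast at h ⊢
    rw [h]
  simp_rw [hphase]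
  rw [setIntegral_cexp_mul_u1WilsonWeight inc βp fun l => ∑ p, s p * inc p l]
  congr 1
  exact tsum_ite_eq_tsum_of_range _ (injective_const_sub_mult s)
    (linkConstraint_mult_iff_mem_range inc hclosed hconn s)

omit [DecidableEq ι] in
/-- The shifted products are summable over `k`. -/
theorem summable_prod_besselI_sub_mult [Nonempty ι] (s : ι → ℤ) :
    Summable fun k : ℤ => ∏ p, besselI (k - s p).natAbs (βp p) := by
  have h := ((summable_norm_prod_besselI βp).of_norm.comp_injective (injective_const_sub_mult s))
  have h2 := Complex.reCLM.summable h
  refine h2.congr fun k => ?_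
  simp only [Function.comp_apply, Complex.reCLM_apply, ← Complex.ofReal_prod, Complex.ofReal_re]

/-- **The cosine probe with multiplicities**:
`∫ cos(Σ_p s_p θ_p) W dθ = (2π)^{n+1} Σ_k (∏_p I_{|k−s_p|}(β_p) + ∏_p I_{|k+s_p|}(β_p))/2`. -/
theorem setIntegral_cos_mult_mul_weight [Nonempty ι] (hclosed : ∀ l, ∑ p, inc p l = 0)
    (hconn : ∀ m : ι → ℤ, (∀ l, ∑ p, m p * inc p l = 0) → ∀ p q, m p = m q) (s : ι → ℤ) :
    ∫ θ in u1TorusBox (n + 1),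
        Real.cos (∑ p, (s p : ℝ) * u1PlaqAngle inc p θ) * u1WilsonWeight univ inc βp θ =
      (2 * π) ^ (n + 1) * ∑' k : ℤ, ((∏ p, besselI (k - s p).natAbs (βp p)) +
        ∏ p, besselI (k + s p).natAbs (βp p)) / 2 := by
  have hW := continuous_u1WilsonWeight univ inc βp
  have hA := fun p => continuous_u1PlaqAngle inc p
  have hI : ∀ s : ι → ℤ, Integrable (fun θ : Fin (n + 1) → ℝ =>
      Complex.exp ((∑ p, (s p : ℂ) * (u1PlaqAngle inc p θ : ℂ)) * Complex.I) *
        ((u1WilsonWeight univ inc βp θ : ℝ) : ℂ))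
      ((volume : Measure (Fin (n + 1) → ℝ)).restrict (u1TorusBox (n + 1))) := fun s =>
    integrableOn_u1TorusBox' (by fun_prop)
  have h1 := setIntegral_cexp_mult_mul_weight inc βp hclosed hconn s
  have h2 : ∫ θ in u1TorusBox (n + 1),
      Complex.exp (-((∑ p, (s p : ℂ) * (u1PlaqAngle inc p θ : ℂ)) * Complex.I)) *
        ((u1WilsonWeight univ inc βp θ : ℝ) : ℂ) =
      (2 * π : ℂ) ^ (n + 1) * ∑' k : ℤ, ∏ p, (besselI (k + s p).natAbs (βp p) : ℂ) := by
    have h := setIntegral_cexp_mult_mul_weight inc βp hclosed hconn (-s)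
    simp only [Pi.neg_apply, Int.cast_neg, neg_mul, Finset.sum_neg_distrib, sub_neg_eq_add] at h
    exact h
  have hI2 : Integrable (fun θ : Fin (n + 1) → ℝ =>
      Complex.exp (-((∑ p, (s p : ℂ) * (u1PlaqAngle inc p θ : ℂ)) * Complex.I)) *
        ((u1WilsonWeight univ inc βp θ : ℝ) : ℂ))
      ((volume : Measure (Fin (n + 1) → ℝ)).restrict (u1TorusBox (n + 1))) :=
    integrableOn_u1TorusBox' (by fun_prop)
  apply Complex.ofReal_injective
  rw [← integral_complex_ofReal]
  have hsplit : ∀ θ : Fin (n + 1) → ℝ,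
      (((Real.cos (∑ p, (s p : ℝ) * u1PlaqAngle inc p θ) * u1WilsonWeight univ inc βp θ : ℝ)) : ℂ) =
        (1 / 2 : ℂ) * (Complex.exp ((∑ p, (s p : ℂ) * (u1PlaqAngle inc p θ : ℂ)) * Complex.I) *
            ((u1WilsonWeight univ inc βp θ : ℝ) : ℂ)) +
          (1 / 2 : ℂ) * (Complex.exp (-((∑ p, (s p : ℂ) * (u1PlaqAngle inc p θ : ℂ)) * Complex.I)) *
            ((u1WilsonWeight univ inc βp θ : ℝ) : ℂ)) := fun θ => by
    push_cast
    rw [Complex.cos]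
    ring_nf
  simp_rw [hsplit]
  rw [integral_add ((hI s).const_mul _) (hI2.const_mul _), MeasureTheory.integral_const_mul,
    MeasureTheory.integral_const_mul, h1, h2]
  have hs1 := summable_prod_besselI_sub_mult βp s
  have hs2 : Summable fun k : ℤ => ∏ p, besselI (k + s p).natAbs (βp p) := by
    have h := summable_prod_besselI_sub_mult βp (-s)
    simp only [Pi.neg_apply, sub_neg_eq_add] at h
    exact h
  have key : ∑' k : ℤ, ((∏ p, besselI (k - s p).natAbs (βp p)) +
        ∏ p, besselI (k + s p).natAbs (βp p)) / 2 =
      1 / 2 * ∑' k : ℤ, ∏ p, besselI (k - s p).natAbs (βp p) +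
        1 / 2 * ∑' k : ℤ, ∏ p, besselI (k + s p).natAbs (βp p) := by
    rw [← tsum_mul_left, ← tsum_mul_left, ← (hs1.mul_left _).tsum_add (hs2.mul_left _)]
    refine tsum_congr fun k => ?_
    ring
  rw [key]
  push_cast
  ring

/-! ### 2. Two distinct plaquettes -/

omit [Fintype ι] in
/-- Splitting two factors off a product over a finite type. -/
theorem prod_eq_mul_mul_prod_erase_erase [Fintype ι] {p q : ι} (hpq : p ≠ q) (F : ι → ℝ) :
    ∏ r, F r = F p * F q * ∏ r ∈ (univ.erase p).erase q, F r := by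
  rw [← Finset.mul_prod_erase univ F (Finset.mem_univ p),
    ← Finset.mul_prod_erase (univ.erase p) F (Finset.mem_erase.mpr ⟨hpq.symm, Finset.mem_univ q⟩),
    mul_assoc]

/-- **The two-plaquette numerator on a closed connected complex** (`p ≠ q`):
`∫ cos θ_p cos θ_q W dθ = (2π)^{n+1} Σ_k (∏_{r ≠ p,q} I_{|k|}(β_r)) I_k'(β_p) I_k'(β_q)`,
`I_k'(β) = (I_{|k−1|}(β) + I_{|k+1|}(β))/2`. -/
theorem setIntegral_cos_mul_cos_mul_weight [Nonempty ι] (hclosed : ∀ l, ∑ p, inc p l = 0)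
    (hconn : ∀ m : ι → ℤ, (∀ l, ∑ p, m p * inc p l = 0) → ∀ p q, m p = m q) {p q : ι} (hpq : p ≠ q) :
    ∫ θ in u1TorusBox (n + 1),
        Real.cos (u1PlaqAngle inc p θ) * Real.cos (u1PlaqAngle inc q θ) * u1WilsonWeight univ inc βp θ =
      (2 * π) ^ (n + 1) * ∑' k : ℤ, (∏ r ∈ (univ.erase p).erase q, besselI k.natAbs (βp r)) *
        (((besselI (k - 1).natAbs (βp p) + besselI (k + 1).natAbs (βp p)) / 2) *
          ((besselI (k - 1).natAbs (βp q) + besselI (k + 1).natAbs (βp q)) / 2)) := by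
  -- the two probes `𝟙_p + 𝟙_q` and `𝟙_p − 𝟙_q`
  set sp : ι → ℤ := fun r => (if r = p then 1 else 0) + (if r = q then 1 else 0) with hsp
  set sm : ι → ℤ := fun r => (if r = p then 1 else 0) - (if r = q then 1 else 0) with hsm
  have hqp : q ≠ p := hpq.symm
  have hp : ∀ θ : Fin (n + 1) → ℝ, ∑ r, (sp r : ℝ) * u1PlaqAngle inc r θ =
      u1PlaqAngle inc p θ + u1PlaqAngle inc q θ := fun θ => by
    simp only [hsp, Int.cast_add, Int.cast_ite, Int.cast_one, Int.cast_zero, add_mul, ite_mul,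
      one_mul, zero_mul, Finset.sum_add_distrib, Finset.sum_ite_eq', Finset.mem_univ, if_true]
  have hm : ∀ θ : Fin (n + 1) → ℝ, ∑ r, (sm r : ℝ) * u1PlaqAngle inc r θ =
      u1PlaqAngle inc p θ - u1PlaqAngle inc q θ := fun θ => by
    simp only [hsm, Int.cast_sub, Int.cast_ite, Int.cast_one, Int.cast_zero, sub_mul, ite_mul,
      one_mul, zero_mul, Finset.sum_sub_distrib, Finset.sum_ite_eq', Finset.mem_univ, if_true]
  have hcos : ∀ θ : Fin (n + 1) → ℝ,
      Real.cos (u1PlaqAngle inc p θ) * Real.cos (u1PlaqAngle inc q θ) * u1WilsonWeight univ inc βp θ =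
        1 / 2 * (Real.cos (∑ r, (sp r : ℝ) * u1PlaqAngle inc r θ) * u1WilsonWeight univ inc βp θ) +
          1 / 2 * (Real.cos (∑ r, (sm r : ℝ) * u1PlaqAngle inc r θ) *
            u1WilsonWeight univ inc βp θ) := fun θ => by
    rw [hp, hm, Real.cos_add, Real.cos_sub]
    ring
  have hW := continuous_u1WilsonWeight univ inc βp
  have hA := fun r => continuous_u1PlaqAngle inc r
  have hI : ∀ s : ι → ℤ, Integrable (fun θ : Fin (n + 1) → ℝ =>
      Real.cos (∑ r, (s r : ℝ) * u1PlaqAngle inc r θ) * u1WilsonWeight univ inc βp θ)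
      ((volume : Measure (Fin (n + 1) → ℝ)).restrict (u1TorusBox (n + 1))) := fun s =>
    integrableOn_u1TorusBox' (by fun_prop)
  simp_rw [hcos]
  rw [integral_add ((hI sp).const_mul _) ((hI sm).const_mul _), MeasureTheory.integral_const_mul,
    MeasureTheory.integral_const_mul, setIntegral_cos_mult_mul_weight inc βp hclosed hconn sp,
    setIntegral_cos_mult_mul_weight inc βp hclosed hconn sm]
  -- evaluate the four shifted products
  have hsp_p : sp p = 1 := by simp [hsp, hpq]
  have hsp_q : sp q = 1 := by simp [hsp, hqp]
  have hsm_p : sm p = 1 := by simp [hsm, hpq]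
  have hsm_q : sm q = -1 := by simp [hsm, hqp]
  have hsp_r : ∀ r ∈ (univ.erase p).erase q, sp r = 0 := fun r hr => by
    simp only [Finset.mem_erase, Finset.mem_univ, and_true] at hr
    simp [hsp, hr.1, hr.2]
  have hsm_r : ∀ r ∈ (univ.erase p).erase q, sm r = 0 := fun r hr => by
    simp only [Finset.mem_erase, Finset.mem_univ, and_true] at hr
    simp [hsm, hr.1, hr.2]
  have e1 : ∀ k : ℤ, ∏ r, besselI (k - sp r).natAbs (βp r) =
      besselI (k - 1).natAbs (βp p) * besselI (k - 1).natAbs (βp q) *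
        ∏ r ∈ (univ.erase p).erase q, besselI k.natAbs (βp r) := fun k => by
    rw [prod_eq_mul_mul_prod_erase_erase hpq, hsp_p, hsp_q]
    congr 1
    exact Finset.prod_congr rfl fun r hr => by rw [hsp_r r hr, sub_zero]
  have e2 : ∀ k : ℤ, ∏ r, besselI (k + sp r).natAbs (βp r) =
      besselI (k + 1).natAbs (βp p) * besselI (k + 1).natAbs (βp q) *
        ∏ r ∈ (univ.erase p).erase q, besselI k.natAbs (βp r) := fun k => by
    rw [prod_eq_mul_mul_prod_erase_erase hpq, hsp_p, hsp_q]
    congr 1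
    exact Finset.prod_congr rfl fun r hr => by rw [hsp_r r hr, add_zero]
  have e3 : ∀ k : ℤ, ∏ r, besselI (k - sm r).natAbs (βp r) =
      besselI (k - 1).natAbs (βp p) * besselI (k + 1).natAbs (βp q) *
        ∏ r ∈ (univ.erase p).erase q, besselI k.natAbs (βp r) := fun k => by
    rw [prod_eq_mul_mul_prod_erase_erase hpq, hsm_p, hsm_q, sub_neg_eq_add]
    congr 1
    exact Finset.prod_congr rfl fun r hr => by rw [hsm_r r hr, sub_zero]
  have e4 : ∀ k : ℤ, ∏ r, besselI (k + sm r).natAbs (βp r) =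
      besselI (k + 1).natAbs (βp p) * besselI (k - 1).natAbs (βp q) *
        ∏ r ∈ (univ.erase p).erase q, besselI k.natAbs (βp r) := fun k => by
    rw [prod_eq_mul_mul_prod_erase_erase hpq, hsm_p, hsm_q, ← sub_eq_add_neg]
    congr 1
    exact Finset.prod_congr rfl fun r hr => by rw [hsm_r r hr, add_zero]
  have hs1 := summable_prod_besselI_sub_mult βp sp
  have hs2 : Summable fun k : ℤ => ∏ r, besselI (k + sp r).natAbs (βp r) := by
    have h := summable_prod_besselI_sub_mult βp (-sp)
    simp only [Pi.neg_apply, sub_neg_eq_add] at h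
    exact h
  have hs3 := summable_prod_besselI_sub_mult βp sm
  have hs4 : Summable fun k : ℤ => ∏ r, besselI (k + sm r).natAbs (βp r) := by
    have h := summable_prod_besselI_sub_mult βp (-sm)
    simp only [Pi.neg_apply, sub_neg_eq_add] at h
    exact h
  have hS1 : Summable fun k : ℤ => ((∏ r, besselI (k - sp r).natAbs (βp r)) +
      ∏ r, besselI (k + sp r).natAbs (βp r)) / 2 := (hs1.add hs2).div_const 2
  have hS2 : Summable fun k : ℤ => ((∏ r, besselI (k - sm r).natAbs (βp r)) +
      ∏ r, besselI (k + sm r).natAbs (βp r)) / 2 := (hs3.add hs4).div_const 2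
  rw [← mul_assoc, ← mul_assoc, mul_comm (1 / 2 : ℝ), mul_assoc, mul_assoc, ← mul_add,
    ← tsum_mul_left, ← tsum_mul_left, ← (hS1.mul_left _).tsum_add (hS2.mul_left _)]
  congr 1
  refine tsum_congr fun k => ?_
  rw [e1, e2, e3, e4]
  ring

/-- **The correlation of two distinct plaquettes on a closed connected complex** (`p ≠ q`):
`⟨cos θ_p cos θ_q⟩ = Σ_k (∏_{r≠p,q} I_{|k|}(β_r)) I_k'(β_p) I_k'(β_q) / Σ_k ∏_r I_{|k|}(β_r)`. -/
theorem u1WilsonExpect_cos_mul_cos [Nonempty ι] (hclosed : ∀ l, ∑ p, inc p l = 0)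
    (hconn : ∀ m : ι → ℤ, (∀ l, ∑ p, m p * inc p l = 0) → ∀ p q, m p = m q) {p q : ι} (hpq : p ≠ q) :
    u1WilsonExpect univ inc βp
        (fun θ => Real.cos (u1PlaqAngle inc p θ) * Real.cos (u1PlaqAngle inc q θ)) =
      (∑' k : ℤ, (∏ r ∈ (univ.erase p).erase q, besselI k.natAbs (βp r)) *
        (((besselI (k - 1).natAbs (βp p) + besselI (k + 1).natAbs (βp p)) / 2) *
          ((besselI (k - 1).natAbs (βp q) + besselI (k + 1).natAbs (βp q)) / 2))) /
        ∑' k : ℤ, ∏ r, besselI k.natAbs (βp r) := by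
  rw [u1WilsonExpect, setIntegral_cos_mul_cos_mul_weight inc βp hclosed hconn hpq,
    u1WilsonZ_eq_tsum_const inc βp hclosed hconn,
    mul_div_mul_left _ _ (by positivity : (2 * π : ℝ) ^ (n + 1) ≠ 0)]

/-- **Uniform coupling** (`V = #ι` plaquettes, `p ≠ q`):
`⟨cos θ_p cos θ_q⟩ = Σ_k I_{|k|}^{V−2} (I_k')² / Σ_k I_{|k|}^V` — the same for every pair of distinct plaquettes. -/
theorem u1WilsonExpect_cos_mul_cos_uniform [Nonempty ι] (hclosed : ∀ l, ∑ p, inc p l = 0)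
    (hconn : ∀ m : ι → ℤ, (∀ l, ∑ p, m p * inc p l = 0) → ∀ p q, m p = m q) (β : ℝ) {p q : ι}
    (hpq : p ≠ q) :
    u1WilsonExpect univ inc (fun _ => β)
        (fun θ => Real.cos (u1PlaqAngle inc p θ) * Real.cos (u1PlaqAngle inc q θ)) =
      (∑' k : ℤ, besselI k.natAbs β ^ (Fintype.card ι - 2) *
          ((besselI (k - 1).natAbs β + besselI (k + 1).natAbs β) / 2) ^ 2) /
        ∑' k : ℤ, besselI k.natAbs β ^ Fintype.card ι := by
  rw [u1WilsonExpect_cos_mul_cos inc _ hclosed hconn hpq]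
  have hcard : ((univ.erase p).erase q).card = Fintype.card ι - 2 := by
    rw [Finset.card_erase_of_mem (Finset.mem_erase.mpr ⟨hpq.symm, Finset.mem_univ q⟩),
      Finset.card_erase_of_mem (Finset.mem_univ p), Finset.card_univ, Nat.sub_sub]
  simp only [Finset.prod_const, hcard, Finset.card_univ, sq]

end Closed

/-! ### 3. The `L₁ × L₂` torus -/

section Torus

variable {L₁ L₂ : ℕ} [NeZero L₁] [NeZero L₂] {n : ℕ}
  (e : Fin 2 × (Fin L₁ × Fin L₂) ≃ Fin (n + 1))

/-- **THE PAIR CORRELATION OF THE 2-d `U(1)` TORUS.**  For every `L₁, L₂ ≥ 1`, every real `β` and every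
two distinct plaquettes `x ≠ y` (adjacent or not):
`⟨cos θ_x cos θ_y⟩_{L₁×L₂,β} = Σ_k I_{|k|}(β)^{L₁L₂−2} ((I_{|k−1|}(β)+I_{|k+1|}(β))/2)² / Σ_k I_{|k|}(β)^{L₁L₂}`. -/
theorem torus_u1WilsonExpect_cos_mul_cos (β : ℝ) {x y : Fin L₁ × Fin L₂} (hxy : x ≠ y) :
    u1WilsonExpect univ (torusInc e) (fun _ => β)
        (fun θ => Real.cos (u1PlaqAngle (torusInc e) x θ) * Real.cos (u1PlaqAngle (torusInc e) y θ)) =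
      (∑' k : ℤ, besselI k.natAbs β ^ (L₁ * L₂ - 2) *
          ((besselI (k - 1).natAbs β + besselI (k + 1).natAbs β) / 2) ^ 2) /
        ∑' k : ℤ, besselI k.natAbs β ^ (L₁ * L₂) := by
  rw [u1WilsonExpect_cos_mul_cos_uniform _ (torusInc_closed e) (torusInc_conn e) β hxy]
  simp [Fintype.card_prod, Fintype.card_fin]

end Torus

/-! ### 4. The joint law of the plaquette angles (appended, GEN-13) -/

section Joint

variable {n : ℕ} {ι : Type*} [Fintype ι] [DecidableEq ι] (inc : ι → Fin (n + 1) → ℤ) (βp : ι → ℝ)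

/-- **The joint characteristic function of the plaquette angles on a closed connected complex.**
For every integer multiplicity `s : ι → ℤ`:
`⟨cos(Σ_p s_p θ_p)⟩ = Σ_k (∏_p I_{|k−s_p|}(β_p) + ∏_p I_{|k+s_p|}(β_p))/2 / Σ_k ∏_p I_{|k|}(β_p)` — all joint
moments of the plaquette angles: they are distributed as independent angles with densities
`∝ e^{β_p cos θ}` conditioned on `Σ_p θ_p ∈ 2πℤ`. -/
theorem u1WilsonExpect_cos_mult [Nonempty ι] (hclosed : ∀ l, ∑ p, inc p l = 0)
    (hconn : ∀ m : ι → ℤ, (∀ l, ∑ p, m p * inc p l = 0) → ∀ p q, m p = m q) (s : ι → ℤ) :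
    u1WilsonExpect univ inc βp (fun θ => Real.cos (∑ p, (s p : ℝ) * u1PlaqAngle inc p θ)) =
      (∑' k : ℤ, ((∏ p, besselI (k - s p).natAbs (βp p)) + ∏ p, besselI (k + s p).natAbs (βp p)) / 2) /
        ∑' k : ℤ, ∏ p, besselI k.natAbs (βp p) := by
  rw [u1WilsonExpect, setIntegral_cos_mult_mul_weight inc βp hclosed hconn s,
    u1WilsonZ_eq_tsum_const inc βp hclosed hconn,
    mul_div_mul_left _ _ (by positivity : (2 * π : ℝ) ^ (n + 1) ≠ 0)]

end Joint

section TorusJoint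

variable {L₁ L₂ : ℕ} [NeZero L₁] [NeZero L₂] {n : ℕ}
  (e : Fin 2 × (Fin L₁ × Fin L₂) ≃ Fin (n + 1))

/-- **THE JOINT LAW OF THE PLAQUETTE ANGLES OF THE 2-d `U(1)` TORUS.**  For every `L₁, L₂ ≥ 1`, real `β`
and integer multiplicities `s` on the plaquettes:
`⟨cos(Σ_x s_x θ_x)⟩_{L₁×L₂,β} = Σ_k (∏_x I_{|k−s_x|}(β) + ∏_x I_{|k+s_x|}(β))/2 / Σ_k I_{|k|}(β)^{L₁L₂}`. -/
theorem torus_u1WilsonExpect_cos_mult (β : ℝ) (s : Fin L₁ × Fin L₂ → ℤ) :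
    u1WilsonExpect univ (torusInc e) (fun _ => β)
        (fun θ => Real.cos (∑ x, (s x : ℝ) * u1PlaqAngle (torusInc e) x θ)) =
      (∑' k : ℤ, ((∏ x, besselI (k - s x).natAbs β) + ∏ x, besselI (k + s x).natAbs β) / 2) /
        ∑' k : ℤ, besselI k.natAbs β ^ (L₁ * L₂) := by
  rw [u1WilsonExpect_cos_mult _ _ (torusInc_closed e) (torusInc_conn e) s]
  simp [Fintype.card_prod, Fintype.card_fin]

end TorusJoint

end Summit.Ventures.LatticeQCDFlow.Scoring
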